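import Summits.BirchSwinnertonDyer.BirchSwinnertonDyer.Theorems.PrintCf2SplitBadTwoHPrimeBookkeeping
import Summits.BirchSwinnertonDyer.BirchSwinnertonDyer.Theorems.PrintCf2SplitBadTwoGeneratorPairSupply
import Literature.NumberTheory.EllipticCurves.FineSelmerLimThm35AtTwoUpstairsProofs
import Literature.NumberTheory.EllipticCurves.IwasawaCyclotomicProofs
import HarnessLib

/-!
# H′-bookkeeping, part 3: `K(√2) ⊂ K̃_∞` (every imaginary quadratic `K`) and, for `K = ℚ(√−7)`,
# the cyclotomic character takes the value `−1` on `Υ = Gal(K̄/K̃_∞)` — UNCONDITIONAL (the rank-2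
# input is the tree's class-field-theoretic theorem `zpRank_eq_nrComplexPlaces_add_one_holds`)

Cell `bsd-print-cf2`, width seat `bsd-line-cf2-p1-w8` g6; crux `stmt-BirchSwinnertonDyer-20368`
`PrintCf2.SplitBadTwoRankOneOfFacts`; -plan g20 ruling R-CLASS-4 (H′-BOOKKEEPING for LEAD g15's
`RULING-THETA-RANGE-g15.md` §2 / the dictionary door `GoodTwistDictionaryAtTwo` of the class line
«yager_twist_dictionary»: «`K(√u) ⊂ K̃_∞ ⇔ u ∈ {1, 2, −7, −14}·(ℚˣ)²`», «on `Υ`: `χ_2 = 1`, `χ_{−1} = χ_{−2} =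
χ_{K(i)} = ε₁ε₂ ≠ 1`»).  `--supports` the crux; Theses-free; THEOREMS ONLY (no definition, no named
fact, no `sorry`).  cf2c-w2 g8 (14:41:34Z Q1) asked for the rank hypothesis to be DISPLAYED ((b2)); it is
instead DISCHARGED here, because the tree already proves it: -w4 g7's `GeneratorPairSupply.apply_eq_one_of_mem_pairKer`
(every continuous `Γ_K →ₜ* ℤ₂` kills `pairKer κ₁ κ₂` for every generator pair of an imaginary quadratic
field, from `ZpExtension.zpRank_eq_nrComplexPlaces_add_one_holds` ← `exists_isGlobalReciprocityMap_holds`).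

* §1 `cyclotomicCharacter_mem_torsion_of_mem_pairKer` — `K` imaginary quadratic, any prime `p`, any
  generator pair: `σ ∈ pairKer κ₁ κ₂ ⟹ χ_p(σ) ∈ μ(ℤ_p)` (the continuous logarithm
  `ℓ : ℤ_pˣ →ₜ* ℤ_p` with `ker ℓ = μ(ℤ_p)`, `PadicInt.exists_continuousMonoidHom_ker_eq_torsion`, composed with
  `χ_p` is a continuous `ℤ_p`-valued character, hence dies on `pairKer`); i.e. **the cyclotomic
  `ℤ_p`-extension is a line of the `ℤ_p²`-tower**.  At `p = 2`: `χ₂(σ) = ±1`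
  (`cyclotomicCharacter_eq_one_or_eq_neg_one_of_mem_pairKer`).
* §2 `smul_eq_self_of_sq_eq_two_of_cyclotomicCharacter_mem_torsion` — `r² = 2`, `χ₂(σ) ∈ {±1}` ⟹ `σ • r = r`
  (`r = ζ + ζ⁻¹` for the primitive 8th root `ζ = (1 + i)/r`, and `σζ = ζ^{±1}` by `GaloisRep.cyclotomicCharacter_spec`).
* §3 ★ `forall_mem_pairKer_smul_sqrt_two_eq` — **`K(√2) ⊂ K̃_∞`**: every `σ ∈ pairKer κ₁ κ₂` fixes every
  `r` with `r² = 2` (EVERY imaginary quadratic `K`, every generator pair, `p = 2`); `smul_mul_sqrt_two_eq_iff`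
  (`χ_{−2}|_Υ = χ_{−1}|_Υ`: `σ • (i·r) = i·r ↔ σ • i = i` on `pairKer`); and for `d_K = −7`:
  ★ `exists_mem_pairKer_cyclotomicCharacter_eq_neg_one` (some `σ ∈ Υ` has `χ₂(σ) = −1`, i.e. `sign χ_cyc|_Υ =
  ε₁ε₂|_Υ ≠ 1` — from part 2 `exists_mem_pairKer_smul_sqrt_neg_one_eq_neg` and
  `FineSelmerUpstairs.smul_eq_self_of_cyclotomicCharacter_eq_one`), `cyclotomicCharacter_eq_neg_one_iff_smul_sqrt_neg_one`
  (on `Υ`: `χ₂(σ) = −1 ↔ σ • i = −i`).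

HONEST FRAMING: bookkeeping on top of tree theorems; closes nothing by itself; beyond-print theorem: no.
No summit statement is proved by this seat; BSD is not proved by any of this.

## References
* [Washington1997] L. C. Washington, *Introduction to Cyclotomic Fields* (2nd ed. 1997), §13.1, Thm. 13.4.
* [Serre1973] J.-P. Serre, *A Course in Arithmetic* (1973), Ch. II §3.2 (units of `ℤ₂`), Ch. III §1.
* [Serre1968] J.-P. Serre, *Abelian ℓ-adic representations and elliptic curves* (1968), Ch. I §1.2.
* [deShalit1987] E. de Shalit, *Iwasawa theory of elliptic curves with complex multiplication* (1987), II.4.13.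
-/

-- the summit namespace `Summit.BirchSwinnertonDyer.BirchSwinnertonDyer` repeats the problem name by design (D-0017)
set_option linter.dupNamespace false
set_option autoImplicit false

noncomputable section

open scoped Classical

open Field NumberField Literature.NumberTheory.EllipticCurves Literature.NumberTheory.GaloisRepresentations
open Literature.NumberTheory.EllipticCurves.FineSelmerUpstairs
  (units_eq_one_or_eq_neg_one_of_mem_torsion_two smul_eq_self_iff_toZModPow_two_cyclotomicCharacter_eq_one
    smul_eq_self_of_cyclotomicCharacter_eq_one)

namespace Summit.BirchSwinnertonDyer.BirchSwinnertonDyer.Theorems.PrintCf2.HPrime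

variable {K : Type} [Field K] [NumberField K]

/-! ## §1. The cyclotomic character is torsion on `pairKer` (rank 2, tree theorem) -/

/-- **The cyclotomic `ℤ_p`-extension is a line of the `ℤ_p²`-tower**: for `K` imaginary quadratic, any
prime `p` and any generator pair `(κ₁, κ₂; γ₁, γ₂)`, every `σ ∈ pairKer κ₁ κ₂ = Gal(K̄/K̃_∞)` has
`χ_p(σ) ∈ μ(ℤ_p) = (ℤ_pˣ)_{tors}` — the continuous character `ℓ ∘ χ_p : Γ_K →ₜ* ℤ_p` (`ker ℓ = μ(ℤ_p)`) dies on
`pairKer` by the tree's rank theorem (`GeneratorPairSupply.apply_eq_one_of_mem_pairKer`).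
[cite: Washington1997, §13.1 and Thm. 13.4] [cite: deShalit1987, II.4.13] -/
theorem cyclotomicCharacter_mem_torsion_of_mem_pairKer (hK : IsImaginaryQuadratic K) {p : ℕ} [Fact p.Prime]
    {κ₁ κ₂ : ZpExtension K p} {γ₁ γ₂ : absoluteGaloisGroup K} (hγ : ZpExtension.IsTopGeneratorPair κ₁ κ₂ γ₁ γ₂)
    {σ : absoluteGaloisGroup K} (hσ : σ ∈ ZpExtension.pairKer κ₁ κ₂) :
    GaloisRep.cyclotomicCharacter K p σ ∈ CommGroup.torsion ℤ_[p]ˣ := by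
  obtain ⟨L, hL⟩ := Literature.NumberTheory.EllipticCurves.PadicInt.exists_continuousMonoidHom_ker_eq_torsion (p := p)
  have h := GeneratorPairSupply.apply_eq_one_of_mem_pairKer hK.unitsRank_eq_zero hK.nrComplexPlaces_eq_one hγ
    (L.comp (GaloisRep.cyclotomicCharacter K p)) hσ
  rw [← hL, MonoidHom.mem_ker]
  exact h

/-- At `p = 2`: **`χ₂(σ) = 1` or `χ₂(σ) = −1` for every `σ ∈ pairKer κ₁ κ₂`** (`μ(ℤ₂) = {±1}`).
[cite: Washington1997, Thm. 13.4] [cite: Serre1973, Ch. II §3.2] -/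
theorem cyclotomicCharacter_eq_one_or_eq_neg_one_of_mem_pairKer (hK : IsImaginaryQuadratic K)
    {κ₁ κ₂ : ZpExtension K 2} {γ₁ γ₂ : absoluteGaloisGroup K} (hγ : ZpExtension.IsTopGeneratorPair κ₁ κ₂ γ₁ γ₂)
    {σ : absoluteGaloisGroup K} (hσ : σ ∈ ZpExtension.pairKer κ₁ κ₂) :
    GaloisRep.cyclotomicCharacter K 2 σ = 1 ∨ GaloisRep.cyclotomicCharacter K 2 σ = -1 :=
  units_eq_one_or_eq_neg_one_of_mem_torsion_two (cyclotomicCharacter_mem_torsion_of_mem_pairKer hK hγ hσ)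

/-! ## §2. `χ₂(σ) = ±1 ⟹ σ` fixes `√2` -/

omit [NumberField K] in
/-- **`χ₂(σ) ∈ {±1}` forces `σ • r = r` for `r² = 2`** (characteristic `0`): with `i² = −1` the element
`ζ := (1 + i)·r⁻¹` is a primitive 8th root of unity with `ζ + ζ⁻¹ = r`, and `σ • ζ = ζ^{χ₂(σ) mod 8} = ζ^{±1}`
(`GaloisRep.cyclotomicCharacter_spec`). [cite: Serre1968, Ch. I §1.2] -/
theorem smul_eq_self_of_sq_eq_two_of_cyclotomicCharacter_mem_torsion [CharZero K] {r : AlgebraicClosure K}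
    (hr : r ^ 2 = 2) {σ : absoluteGaloisGroup K}
    (hσ : GaloisRep.cyclotomicCharacter K 2 σ = 1 ∨ GaloisRep.cyclotomicCharacter K 2 σ = -1) : σ • r = r := by
  haveI : NeZero ((2 : ℕ) : K) := ⟨by exact_mod_cast (two_ne_zero : (2 : K) ≠ 0)⟩
  haveI : Fact (1 < 2 ^ 3) := ⟨by norm_num⟩
  obtain ⟨i, hi⟩ := IsAlgClosed.exists_pow_nat_eq (-1 : AlgebraicClosure K) two_pos
  have hr0 : r ≠ 0 := by rintro rfl; norm_num at hr
  -- the primitive 8th root of unity `ζ = (1 + i)/r`, with `ζ⁻¹ = (1 − i)/r` and `ζ + ζ⁻¹ = 2/r = r`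
  set ζ : AlgebraicClosure K := (1 + i) * r⁻¹ with hζ_def
  have hζ2 : ζ ^ 2 = i := by
    rw [hζ_def, mul_pow, inv_pow, hr]
    have : (1 + i) ^ 2 = 2 * i := by linear_combination hi
    rw [this]; field_simp
  have hζ4 : ζ ^ 4 = -1 := by
    rw [show (4 : ℕ) = 2 * 2 by norm_num, pow_mul, hζ2, hi]
  have hζ8 : ζ ^ 2 ^ 3 = 1 := by
    rw [show (2 : ℕ) ^ 3 = 4 * 2 by norm_num, pow_mul, hζ4]; norm_num
  have h8 : ζ ^ 8 = 1 := by simpa using hζ8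
  have hinv : ζ⁻¹ = (1 - i) * r⁻¹ := by
    apply inv_eq_of_mul_eq_one_right
    rw [hζ_def]
    field_simp
    linear_combination (-1 : AlgebraicClosure K) * hi - hr
  have hζr : ζ + ζ⁻¹ = r := by
    have h2r : (2 : AlgebraicClosure K) * r⁻¹ = r := by
      rw [← hr, sq, mul_assoc, mul_inv_cancel₀ hr0, mul_one]
    have hsum : (1 + i) * r⁻¹ + (1 - i) * r⁻¹ = 2 * r⁻¹ := by ring
    rw [hinv, hζ_def, hsum, h2r]
  -- `σ • ζ = ζ^{χ₂(σ) mod 8} = ζ^{±1}`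
  have hspec := GaloisRep.cyclotomicCharacter_spec K 2 (k := 3) σ ζ hζ8
  have hσζ : σ • ζ = ζ ∨ σ • ζ = ζ⁻¹ := by
    rcases hσ with h | h
    · left
      rw [hspec, h, Units.val_one, map_one, ZMod.val_one, pow_one]
    · right
      rw [hspec, h, Units.val_neg, Units.val_one, map_neg, map_one]
      have h7 : ((-1 : ZMod (2 ^ 3))).val = 7 := by decide
      rw [h7]
      have : ζ ^ 7 * ζ = 1 := by rw [← pow_succ]; exact h8
      exact eq_inv_of_mul_eq_one_left this
  calc σ • r = σ • (ζ + ζ⁻¹) := by rw [hζr]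
    _ = σ • ζ + (σ • ζ)⁻¹ := by rw [smul_add, smul_inv'']
    _ = ζ + ζ⁻¹ := by rcases hσζ with h | h <;> simp [h, add_comm]
    _ = r := hζr

/-! ## §3. Consumer statements on `Υ = pairKer κ₁ κ₂` -/

/-- **`K(√2) ⊂ K̃_∞`**: for `K` imaginary quadratic and ANY generator pair `(κ₁, κ₂; γ₁, γ₂)` of its
`ℤ₂²`-tower, every `σ ∈ pairKer κ₁ κ₂ = Gal(K̄/K̃_∞)` fixes every `r` with `r² = 2` — the quadratic character
`χ_2` is trivial on `Υ` (LEAD g15 RULING-THETA-RANGE §2: `χ_2|_Υ = χ_{−7}|_Υ = 1`).  Unconditional: rank 2 is the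
tree's class-field-theoretic theorem. [cite: Washington1997, §13.1, Thm. 13.4] [cite: Serre1968, Ch. I §1.2] -/
theorem forall_mem_pairKer_smul_sqrt_two_eq (hK : IsImaginaryQuadratic K)
    {κ₁ κ₂ : ZpExtension K 2} {γ₁ γ₂ : absoluteGaloisGroup K} (hγ : ZpExtension.IsTopGeneratorPair κ₁ κ₂ γ₁ γ₂)
    {r : AlgebraicClosure K} (hr : r ^ 2 = 2) :
    ∀ σ ∈ ZpExtension.pairKer κ₁ κ₂, σ • r = r := fun _ hσ ↦
  smul_eq_self_of_sq_eq_two_of_cyclotomicCharacter_mem_torsion hr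
    (cyclotomicCharacter_eq_one_or_eq_neg_one_of_mem_pairKer hK hγ hσ)

/-- **`χ_{−2}|_Υ = χ_{−1}|_Υ`**: on `pairKer κ₁ κ₂`, `σ` fixes `i·r` (`(i r)² = −2`) iff it fixes `i`
(`K` imaginary quadratic, any generator pair; `i² = −1`, `r² = 2`). [cite: Washington1997, Thm. 13.4] -/
theorem smul_mul_sqrt_two_eq_iff (hK : IsImaginaryQuadratic K)
    {κ₁ κ₂ : ZpExtension K 2} {γ₁ γ₂ : absoluteGaloisGroup K} (hγ : ZpExtension.IsTopGeneratorPair κ₁ κ₂ γ₁ γ₂)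
    {i r : AlgebraicClosure K} (hr : r ^ 2 = 2) {σ : absoluteGaloisGroup K} (hσ : σ ∈ ZpExtension.pairKer κ₁ κ₂) :
    σ • (i * r) = i * r ↔ σ • i = i := by
  have hr0 : r ≠ 0 := by rintro rfl; norm_num at hr
  rw [smul_mul', forall_mem_pairKer_smul_sqrt_two_eq hK hγ hr σ hσ]
  exact mul_left_injective₀ hr0 |>.eq_iff

/-- **On `Υ`, `χ₂(σ) = −1 ↔ σ • i = −i`** (`K` imaginary quadratic, any generator pair, `i² = −1`): the sign
of the cyclotomic character on `Gal(K̄/K̃_∞)` IS the character of `K(i)/K` restricted there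
(`ε₁ε₂|_Υ = χ_{K(i)}|_Υ` in LEAD g15's notation). [cite: Washington1997, Thm. 13.4] [cite: Serre1968, Ch. I §1.2] -/
theorem cyclotomicCharacter_eq_neg_one_iff_smul_sqrt_neg_one (hK : IsImaginaryQuadratic K)
    {κ₁ κ₂ : ZpExtension K 2} {γ₁ γ₂ : absoluteGaloisGroup K} (hγ : ZpExtension.IsTopGeneratorPair κ₁ κ₂ γ₁ γ₂)
    {i : AlgebraicClosure K} (hi : i ^ 2 = -1) {σ : absoluteGaloisGroup K} (hσ : σ ∈ ZpExtension.pairKer κ₁ κ₂) :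
    GaloisRep.cyclotomicCharacter K 2 σ = -1 ↔ σ • i = -i := by
  have hi0 : i ≠ 0 := by rintro rfl; norm_num at hi
  have hneg : i ≠ -i := fun h ↦ hi0 (by
    have : (2 : AlgebraicClosure K) * i = 0 := by linear_combination h
    simpa using this)
  have hpm : σ • i = i ∨ σ • i = -i := by
    apply sq_eq_sq_iff_eq_or_eq_neg.mp
    rw [← smul_pow', hi, smul_neg, smul_one]
  rcases cyclotomicCharacter_eq_one_or_eq_neg_one_of_mem_pairKer hK hγ hσ with h | h
  · have hfix := smul_eq_self_of_cyclotomicCharacter_eq_one i hi h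
    have hne1 : (1 : ℤ_[2]ˣ) ≠ -1 := fun h1 ↦ by
      have h' := congrArg Units.val h1
      rw [Units.val_one, Units.val_neg, Units.val_one] at h'
      exact two_ne_zero (by linear_combination h' : (2 : ℤ_[2]) = 0)
    rw [h, hfix]
    exact ⟨fun h1 ↦ (hne1 h1).elim, fun h1 ↦ (hneg h1).elim⟩
  · rw [h]
    refine ⟨fun _ ↦ hpm.resolve_left fun hfix ↦ ?_, fun _ ↦ rfl⟩
    have h4 := (smul_eq_self_iff_toZModPow_two_cyclotomicCharacter_eq_one i hi σ).mp hfix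
    rw [h, Units.val_neg, Units.val_one, map_neg, map_one] at h4
    exact absurd h4 (by decide)

/-- **For `K = ℚ(√−7)` the cyclotomic character takes the value `−1` on `Υ`**: some
`σ ∈ pairKer κ₁ κ₂ = Gal(K̄/K̃_∞)` has `χ₂(σ) = −1` — every generator pair (`sign χ_cyc|_Υ = ε₁ε₂|_Υ ≠ 1`;
`K(i) ⊄ K̃_∞`, part 2 `exists_mem_pairKer_smul_sqrt_neg_one_eq_neg`).
[cite: Serre1973, Ch. III §1] [cite: Washington1997, Thm. 13.4] -/
theorem exists_mem_pairKer_cyclotomicCharacter_eq_neg_one (hK : IsImaginaryQuadratic K)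
    (hdK : NumberField.discr K = -7) {κ₁ κ₂ : ZpExtension K 2} {γ₁ γ₂ : absoluteGaloisGroup K}
    (hγ : ZpExtension.IsTopGeneratorPair κ₁ κ₂ γ₁ γ₂) :
    ∃ σ ∈ ZpExtension.pairKer κ₁ κ₂, GaloisRep.cyclotomicCharacter K 2 σ = -1 := by
  obtain ⟨i, hi⟩ := IsAlgClosed.exists_pow_nat_eq (-1 : AlgebraicClosure K) two_pos
  obtain ⟨σ, hσ, hσi⟩ := exists_mem_pairKer_smul_sqrt_neg_one_eq_neg hK hdK hγ hi
  exact ⟨σ, hσ, (cyclotomicCharacter_eq_neg_one_iff_smul_sqrt_neg_one hK hγ hi hσ).mpr hσi⟩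

end Summit.BirchSwinnertonDyer.BirchSwinnertonDyer.Theorems.PrintCf2.HPrime
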